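import Summits.CriticalPhenomena.CardyFormulaZ2.Theses.CardyGluingRDE
import Summits.CriticalPhenomena.CardyFormulaZ2.Theorems.CardyPolygonWordsAssembly

/-!
# `PolygonReduction` (route CardyGluingRDE of `CardyFormulaZ2`)

Item stmt-CriticalPhenomena-4784 read in route CardyGluingRDE: `CardyLatticePolygon → CardyFormulaZ2`
(`PolygonReduction_proof`), the same term as `CardyPolygonWords.Assembly`, proved in
`CardyPolygonWordsAssembly.lean` (`LatticePolygonApproximation.cardyFormulaZ2_of_cardyLatticePolygon`:
the tree's Bollobás–Riordan sandwich re-run with the lattice-polygon approximant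
`exists_latticePolygon_close`).
-/

namespace Summit.CriticalPhenomena.CardyFormulaZ2.Theorems

/-- **`PolygonReduction`** (item stmt-CriticalPhenomena-4784, support of route CardyGluingRDE):
`CardyLatticePolygon → CardyFormulaZ2`. [folklore] -/
theorem PolygonReduction_proof :
    Summit.CriticalPhenomena.CardyFormulaZ2.Theses.CardyGluingRDE.PolygonReduction :=
  fun h => LatticePolygonApproximation.cardyFormulaZ2_of_cardyLatticePolygon h

end Summit.CriticalPhenomena.CardyFormulaZ2.Theorems
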